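import Summits.Ventures.HodgeRepro.LitKType

/-!
# LitKTypeLine — corollaries of the K-type correspondence for a LINE against U(2), U(3), U(2,1)

Blind cell `pub-hodge-repro`, seat lit-2 (gen 4).  Companion of `LitKType.lean` (Ichino arXiv:2002.09148
Lemma 7.8 = KK07 Lemma 5.3 in clean TeX, SOURCES.md lit-2 batch 8): the instances used by ROUTE-B §9.7
and SOURCES.md row KK1, proved from `correspond_posLine_iff` / `correspond_negLine_iff`.

* `posLine_character_iff_def2`, `negLine_character_iff_def2`: against the definite plane U(2) a line's
  character `z^k` meets a CHARACTER `det^u` of U(2) iff it is the vacuum — `k = m₀/2 ± 1`,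
  `u = (n₀ ± 1)/2`, `+` iff the line is positive (`⟨w, w⟩ = +√−1` in IC1's basis, `ψ(x) = e^{−2π√−1 x}`);
  this is ROUTE-B §9.7(i) with the sign pinned.
* `vacuum_gap`, `vacuum_gap_three`, `vacuum_gap_one`: against `V` of signature `(r, s)` the vacuum
  weights of a positive and of a negative line differ by exactly `r − s` — `3` at a definite place of
  signature `(3, 0)`, `1` at a `(2, 1)` place: the magnitudes of the sealed (b) slot rule (row KK1's
  "bearing on the sealed (b)", now a theorem on the printed formula).

No new named fact (D-0026); theorems only.
-/

namespace HodgeRepro.Lit2.KType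

/-- **Definite plane, positive line (ROUTE-B §9.7(i), pinned).**  Against `V = U(2)` (signature
`(2, 0)`) the character `z^k` of a POSITIVE line meets a CHARACTER `det^u` of `U(2)` in the
correspondence iff it is the vacuum: `k = 1 + m₀/2` and `u = (1 + n₀)/2`. -/
theorem posLine_character_iff_def2 (m₀ n₀ k u : ℤ) :
    Correspond 1 0 2 0 m₀ n₀ ([k], []) (List.replicate 2 u, []) ↔
      (2 + m₀) % 2 = 0 ∧ (1 + n₀) % 2 = 0 ∧ k = (2 + m₀) / 2 ∧ u = (1 + n₀) / 2 := by
  rw [correspond_posLine_iff]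
  constructor
  · rintro ⟨hm, hn, ⟨hk, hu⟩ | ⟨a, ha, -, hk, hu⟩ | ⟨b, hb, hs, -, -⟩⟩
    · simp only [Prod.mk.injEq, List.replicate_zero, and_true] at hu
      have hu' := (List.replicate_right_inj (by norm_num : (2 : ℕ) ≠ 0)).1 hu
      push_cast at hm hk
      exact ⟨by simpa using hm, hn, by simpa using hk, hu'⟩
    · exfalso
      simp only [Prod.mk.injEq, List.replicate_zero, and_true] at hu
      rw [show (2 : ℕ) = 1 + 1 from rfl, List.replicate_succ, Nat.add_sub_cancel,
        List.cons.injEq] at hu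
      have := (List.replicate_right_inj (by norm_num : (1 : ℕ) ≠ 0)).1 hu.2
      omega
    · omega
  · rintro ⟨hm, hn, hk, hu⟩
    refine ⟨by simpa using hm, hn, Or.inl ⟨by simpa using hk, ?_⟩⟩
    rw [hu]; simp

/-- **Definite plane, negative line.**  Against `U(2)` the character `z^k` of a NEGATIVE line meets
a character `det^u` iff it is the vacuum: `k = −1 + m₀/2` and `u = (n₀ − 1)/2`. -/
theorem negLine_character_iff_def2 (m₀ n₀ k u : ℤ) :
    Correspond 0 1 2 0 m₀ n₀ ([], [k]) (List.replicate 2 u, []) ↔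
      (2 + m₀) % 2 = 0 ∧ (1 + n₀) % 2 = 0 ∧ k = (-2 + m₀) / 2 ∧ u = (n₀ - 1) / 2 := by
  rw [correspond_negLine_iff]
  constructor
  · rintro ⟨hm, hn, ⟨hk, hu⟩ | ⟨c, hc, hs, -, -⟩ | ⟨d, hd, -, hk, hu⟩⟩
    · simp only [Prod.mk.injEq, List.replicate_zero, and_true] at hu
      have hu' := (List.replicate_right_inj (by norm_num : (2 : ℕ) ≠ 0)).1 hu
      push_cast at hm hk
      exact ⟨by simpa using hm, hn, by simpa using hk, hu'⟩
    · omega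
    · exfalso
      simp only [Prod.mk.injEq, List.replicate_zero, and_true] at hu
      rw [show (2 : ℕ) = 1 + 1 from rfl, List.replicate_succ, Nat.add_sub_cancel, List.replicate_one,
        List.replicate_one, List.singleton_append] at hu
      simp only [List.cons.injEq, and_true] at hu
      obtain ⟨h1, h2⟩ := hu
      omega
  · rintro ⟨hm, hn, hk, hu⟩
    refine ⟨by simpa using hm, hn, Or.inl ⟨by simpa using hk, ?_⟩⟩
    rw [hu]; simp

/-- **The vacuum gap (row KK1, the sealed (b) magnitudes).**  Against `V` of signature `(r, s)` the
vacuum `U(r) × U(s)`-type `det^{(1+n₀)/2} ⊠ det^{(n₀−1)/2}` (positive line) resp.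
`det^{(n₀−1)/2} ⊠ det^{(1+n₀)/2}` (negative line) is met by exactly ONE character of the line,
`k = (r − s + m₀)/2` resp. `(s − r + m₀)/2`; so the two vacuum weights differ by exactly `r − s`:
`3` at a definite place of signature `(3, 0)`, `1` at a place of signature `(2, 1)`. -/
theorem vacuum_gap (r s : ℕ) (m₀ n₀ kp kn : ℤ)
    (hp : Correspond 1 0 r s m₀ n₀ ([kp], [])
      (List.replicate r ((1 + n₀) / 2), List.replicate s ((n₀ - 1) / 2)))
    (hn : Correspond 0 1 r s m₀ n₀ ([], [kn])
      (List.replicate r ((n₀ - 1) / 2), List.replicate s ((1 + n₀) / 2))) :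
    kp - kn = r - s := by
  rw [correspond_posLine_iff] at hp
  rw [correspond_negLine_iff] at hn
  obtain ⟨hm, -, hp⟩ := hp
  obtain ⟨-, -, hn⟩ := hn
  have hkp : kp = ((r : ℤ) - s + m₀) / 2 := by
    rcases hp with ⟨h, -⟩ | ⟨a, ha, hr, -, h⟩ | ⟨b, hb, hs, -, h⟩
    · exact h
    · exfalso
      obtain ⟨r', rfl⟩ : ∃ r', r = r' + 1 := ⟨r - 1, by omega⟩
      have h1 := congrArg Prod.fst h
      dsimp only at h1
      rw [Nat.add_sub_cancel, List.replicate_succ, List.cons.injEq] at h1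
      obtain ⟨h1, -⟩ := h1
      omega
    · exfalso
      obtain ⟨s', rfl⟩ : ∃ s', s = s' + 1 := ⟨s - 1, by omega⟩
      have h2 := congrArg Prod.snd h
      dsimp only at h2
      rw [Nat.add_sub_cancel, List.replicate_succ'] at h2
      have h3 := List.append_cancel_left h2
      rw [List.cons.injEq] at h3
      obtain ⟨h3, -⟩ := h3
      omega
  have hkn : kn = ((s : ℤ) - r + m₀) / 2 := by
    rcases hn with ⟨h, -⟩ | ⟨c, hc, hs, -, h⟩ | ⟨d, hd, hr, -, h⟩
    · exact h
    · exfalso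
      obtain ⟨s', rfl⟩ : ∃ s', s = s' + 1 := ⟨s - 1, by omega⟩
      have h2 := congrArg Prod.snd h
      dsimp only at h2
      rw [Nat.add_sub_cancel, List.replicate_succ, List.cons.injEq] at h2
      obtain ⟨h2, -⟩ := h2
      omega
    · exfalso
      obtain ⟨r', rfl⟩ : ∃ r', r = r' + 1 := ⟨r - 1, by omega⟩
      have h1 := congrArg Prod.fst h
      dsimp only at h1
      rw [Nat.add_sub_cancel, List.replicate_succ'] at h1
      have h3 := List.append_cancel_left h1
      rw [List.cons.injEq] at h3
      obtain ⟨h3, -⟩ := h3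
      omega
  rw [hkp, hkn]
  omega

/-- **Definite place, signature `(3, 0)`:** the vacuum weights of a positive and a negative line against
`U(3)` differ by `3` — the sealed (b) slot magnitude `3` at a definite place (row KK1). -/
theorem vacuum_gap_three (m₀ n₀ kp kn : ℤ)
    (hp : Correspond 1 0 3 0 m₀ n₀ ([kp], []) (List.replicate 3 ((1 + n₀) / 2), []))
    (hn : Correspond 0 1 3 0 m₀ n₀ ([], [kn]) (List.replicate 3 ((n₀ - 1) / 2), [])) :
    kp - kn = 3 := by
  have h := vacuum_gap 3 0 m₀ n₀ kp kn (by simpa using hp) (by simpa using hn)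
  push_cast at h
  omega

/-- **Mixed place, signature `(2, 1)`:** the vacuum weights of a positive and a negative line against
`U(2,1)` differ by `1` — the sealed (b) slot magnitude `1` at a `(2,1)` place (row KK1). -/
theorem vacuum_gap_one (m₀ n₀ kp kn : ℤ)
    (hp : Correspond 1 0 2 1 m₀ n₀ ([kp], [])
      (List.replicate 2 ((1 + n₀) / 2), [(n₀ - 1) / 2]))
    (hn : Correspond 0 1 2 1 m₀ n₀ ([], [kn])
      (List.replicate 2 ((n₀ - 1) / 2), [(1 + n₀) / 2])) :
    kp - kn = 1 := by
  have h := vacuum_gap 2 1 m₀ n₀ kp kn (by simpa using hp) (by simpa using hn)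
  push_cast at h
  omega

/-! ### The mixed plane `U(1,1)`: which torus weights `(ep; em)` pair with a line's character -/

/-- **Mixed plane, positive line (ROUTE-B §9.7(ii) / v1.9 §9.8(d′)).**  Against `V` of signature
`(1, 1)` the character `z^k` of a POSITIVE line pairs with the `U(1) × U(1)`-weight `(e₊; e₋) = (ep; em)` iff
either `e₋ = (n₀ − 1)/2` and `e₊ ≥ (1 + n₀)/2` (vacuum / `a`-family, `a = e₊ − (1 + n₀)/2`), or
`e₊ = (1 + n₀)/2` and `e₋ ≤ (n₀ − 1)/2` (vacuum / `b`-family, `b = e₋ − (n₀ − 1)/2`); `k` is then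
determined. -/
theorem posLine_mixed_iff (m₀ n₀ k ep em : ℤ) :
    Correspond 1 0 1 1 m₀ n₀ ([k], []) ([ep], [em]) ↔
      (2 + m₀) % 2 = 0 ∧ (1 + n₀) % 2 = 0 ∧
      ((em = (n₀ - 1) / 2 ∧ (1 + n₀) / 2 ≤ ep ∧ k = ep - (1 + n₀) / 2 + m₀ / 2) ∨
       (ep = (1 + n₀) / 2 ∧ em ≤ (n₀ - 1) / 2 ∧ k = em - (n₀ - 1) / 2 + m₀ / 2)) := by
  rw [correspond_posLine_iff]
  constructor
  · rintro ⟨hm, hn, ⟨hk, hu⟩ | ⟨a, ha, -, hk, hu⟩ | ⟨b, hb, -, hk, hu⟩⟩ <;>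
      simp only [Prod.mk.injEq, List.replicate_one, Nat.sub_self, List.replicate_zero,
        List.nil_append, List.cons.injEq, and_true] at hu <;>
      push_cast at hm hk <;> omega
  · rintro ⟨hm, hn, h⟩
    refine ⟨by push_cast; omega, hn, ?_⟩
    rcases h with ⟨he, hle, hk⟩ | ⟨he, hle, hk⟩
    · rcases lt_or_eq_of_le hle with hlt | heq
      · right; left
        refine ⟨ep - (1 + n₀) / 2, by omega, le_rfl, by push_cast; omega, ?_⟩
        simp [he]
      · left
        exact ⟨by push_cast; omega, by simp [he, heq]⟩
    · rcases lt_or_eq_of_le hle with hlt | heq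
      · right; right
        refine ⟨em - (n₀ - 1) / 2, by omega, le_rfl, by push_cast; omega, ?_⟩
        simp [he]
      · left
        exact ⟨by push_cast; omega, by simp [he, heq]⟩

/-- **Mixed plane, negative line.**  Against `(1, 1)` the character `z^k` of a NEGATIVE line pairs
with `(e₊; e₋) = (ep; em)` iff either `e₊ = (n₀ − 1)/2` and `e₋ ≥ (1 + n₀)/2` (vacuum / `c`-family), or
`e₋ = (1 + n₀)/2` and `e₊ ≤ (n₀ − 1)/2` (vacuum / `d`-family); `k` is then determined. -/
theorem negLine_mixed_iff (m₀ n₀ k ep em : ℤ) :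
    Correspond 0 1 1 1 m₀ n₀ ([], [k]) ([ep], [em]) ↔
      (2 + m₀) % 2 = 0 ∧ (1 + n₀) % 2 = 0 ∧
      ((ep = (n₀ - 1) / 2 ∧ (1 + n₀) / 2 ≤ em ∧ k = em - (1 + n₀) / 2 + m₀ / 2) ∨
       (em = (1 + n₀) / 2 ∧ ep ≤ (n₀ - 1) / 2 ∧ k = ep - (n₀ - 1) / 2 + m₀ / 2)) := by
  rw [correspond_negLine_iff]
  constructor
  · rintro ⟨hm, hn, ⟨hk, hu⟩ | ⟨c, hc, -, hk, hu⟩ | ⟨d, hd, -, hk, hu⟩⟩ <;>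
      simp only [Prod.mk.injEq, List.replicate_one, Nat.sub_self, List.replicate_zero,
        List.nil_append, List.cons.injEq, and_true] at hu <;>
      push_cast at hm hk <;> omega
  · rintro ⟨hm, hn, h⟩
    refine ⟨by push_cast; omega, hn, ?_⟩
    rcases h with ⟨he, hle, hk⟩ | ⟨he, hle, hk⟩
    · rcases lt_or_eq_of_le hle with hlt | heq
      · right; left
        refine ⟨em - (1 + n₀) / 2, by omega, le_rfl, by push_cast; omega, ?_⟩
        simp [he]
      · left
        exact ⟨by push_cast; omega, by simp [he, heq]⟩
    · rcases lt_or_eq_of_le hle with hlt | heq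
      · right; right
        refine ⟨ep - (n₀ - 1) / 2, by omega, le_rfl, by push_cast; omega, ?_⟩
        simp [he]
      · left
        exact ⟨by push_cast; omega, by simp [he, heq]⟩

/-- **The sealed slot pair on the mixed plane (ROUTE-B v1.9 §9.8(d′), kernel-checked).**  The torus
weight `((m′ + 3ε)/2; (m′ − 3ε)/2)` (`m′` odd, `ε = ±1` — the sealed (b) slot pair at a `(2,1)` place)
pairs with a character of a POSITIVE line iff `ε = +1`, and then `n₀ = m′ − 2` with `k = m₀/2 + 2`
(the `a`-family, `a = 2`) or `n₀ = m′ + 2` with `k = m₀/2 − 2` (the `b`-family, `b = −2`) — never the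
vacuum, never `ε = −1`. -/
theorem posLine_slotPair_iff (m₀ n₀ k m' ε : ℤ) (hε : ε = 1 ∨ ε = -1) (hm' : m' % 2 = 1) :
    Correspond 1 0 1 1 m₀ n₀ ([k], []) ([(m' + 3 * ε) / 2], [(m' - 3 * ε) / 2]) ↔
      (2 + m₀) % 2 = 0 ∧ (1 + n₀) % 2 = 0 ∧ ε = 1 ∧
      ((n₀ = m' - 2 ∧ k = 2 + m₀ / 2) ∨ (n₀ = m' + 2 ∧ k = -2 + m₀ / 2)) := by
  rw [posLine_mixed_iff]
  rcases hε with rfl | rfl <;> constructor <;> intro h <;> omega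

/-- **The sealed slot pair, negative line.**  `((m′ + 3ε)/2; (m′ − 3ε)/2)` pairs with a character of
a NEGATIVE line iff `ε = −1`, and then `n₀ = m′ − 2`, `k = m₀/2 + 2` (`c = 2`) or `n₀ = m′ + 2`,
`k = m₀/2 − 2` (`d = −2`).  With `posLine_slotPair_iff`: the sign of the line is forced to equal `ε`
(route-2's `ς_w = ε_w`). -/
theorem negLine_slotPair_iff (m₀ n₀ k m' ε : ℤ) (hε : ε = 1 ∨ ε = -1) (hm' : m' % 2 = 1) :
    Correspond 0 1 1 1 m₀ n₀ ([], [k]) ([(m' + 3 * ε) / 2], [(m' - 3 * ε) / 2]) ↔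
      (2 + m₀) % 2 = 0 ∧ (1 + n₀) % 2 = 0 ∧ ε = -1 ∧
      ((n₀ = m' - 2 ∧ k = 2 + m₀ / 2) ∨ (n₀ = m' + 2 ∧ k = -2 + m₀ / 2)) := by
  rw [negLine_mixed_iff]
  rcases hε with rfl | rfl <;> constructor <;> intro h <;> omega

end HodgeRepro.Lit2.KType
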